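import Summits.KontsevichZagierPeriods.KontsevichZagierPeriods.Theorems.RootDecompZetaThreeFrontierWordMatchPreludeP9

/-! # `RootDecompZetaThreeFrontierWordMatchPreludeP10` — part 2/6 of the mechanical ≤340-line split of `src.lean`
(split by the decomp-kz census seat for landing; mathematics unchanged; part 2 continues part 1). -/

set_option linter.dupNamespace false

noncomputable section

namespace Summit.KontsevichZagierPeriods.KontsevichZagierPeriods.Theorems.RootDecompZetaThreeFrontierWordMoves
open Set MeasureTheory Literature.NumberTheory.Transcendental
open Literature.ModelTheory.ExponentialFields (IsSemialgebraic)
open Summit.KontsevichZagierPeriods.RootDecompZetaThreeFrontier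

section IBPT1

/-- **THE t₁-IBP MOVE**: `[Δ₃, ibpQ1(P)/den(β₀,β₁+1,γ₁+1,γ₂,α)] ≡ [Δ₂, ibpB1(P)/(y₀^{β₀+β₁} y₁^{β₁} (1-y₀)^{γ₁} (1-y₁)^{γ₁+γ₂} (y₀-y₁)^α)]`
(swap move, rule 2, + one Newton–Leibniz move, rule 3, + rule 1 for the band). -/
theorem ibpT1 (P : MvPolynomial (Fin 3) ℚ) (β₀ β₁ γ₁ γ₂ α : ℕ) (r : KZ.IntegralRep 3) (hd : r.domain = KZ.openOrderedSimplex 3)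
    (hi : EqOn r.integrand (WordLayer.layerF (ibpQ1 P β₁ γ₁) β₀ (β₁ + 1) (γ₁ + 1) γ₂ α) r.domain) :
    ∃ r' : KZ.IntegralRep 2, r'.domain = KZ.openOrderedSimplex 2 ∧
      EqOn r'.integrand (fun y => MvPolynomial.aeval y (ibpB1 P β₁ γ₁) /
        (y 0 ^ (β₀ + β₁) * y 1 ^ β₁ * (1 - y 0) ^ γ₁ * (1 - y 1) ^ (γ₁ + γ₂) * (y 0 - y 1) ^ α)) r'.domain ∧
      KZ.of r - KZ.of r' ∈ KZ.relations := by
  have h1 := swap_move3 r hd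
  have hi' : EqOn (swapRep3 r hd).integrand (fun u => WordLayer.layerF (ibpQ1 P β₁ γ₁) β₀ (β₁ + 1) (γ₁ + 1) γ₂ α (sw3 u))
      (swapRep3 r hd).domain := fun u hu => by
    rw [swapRep3_integrand, hi (by rw [hd]; exact sw3_mem' hu)]
  obtain ⟨r', hd', hi'', hrel⟩ := WordLayer.nlC3 (layerF_sw_sa (ibpQ1 P β₁ γ₁) β₀ (β₁ + 1) (γ₁ + 1) γ₂ α) (layerF_sw_sa P β₀ β₁ γ₁ γ₂ α)
    (layerF_sw_cont P β₀ β₁ γ₁ γ₂ α) (layerF_sw_der P β₀ β₁ γ₁ γ₂ α) (swapRep3 r hd) rfl hi'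
  refine ⟨r', hd', fun y hy => ?_, ?_⟩
  · rw [hd'] at hy
    obtain ⟨hy1, h10, h0⟩ := (mem_simplex_two_iff y).1 hy
    have hy0 : y 0 ≠ 0 := by linarith
    have hy1' : y 1 ≠ 0 := by linarith
    have hz0 : (1 : ℝ) - y 0 ≠ 0 := by linarith
    have hz1 : (1 : ℝ) - y 1 ≠ 0 := by linarith
    have hd01 : y 0 - y 1 ≠ 0 := by linarith
    rw [hi'']
    have e1 : sw3 (Fin.snoc y (y 0)) = ![y 0, y 0, y 1] := by
      funext i; fin_cases i <;> rfl
    have e0 : sw3 (Fin.snoc y (y 1)) = ![y 0, y 1, y 1] := by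
      funext i; fin_cases i <;> rfl
    have g1 : (fun i => MvPolynomial.aeval y ((![MvPolynomial.X 0, MvPolynomial.X 0, MvPolynomial.X 1] :
        Fin 3 → MvPolynomial (Fin 2) ℚ) i)) = ![y 0, y 0, y 1] := by
      funext i; fin_cases i <;> simp
    have g0 : (fun i => MvPolynomial.aeval y ((![MvPolynomial.X 0, MvPolynomial.X 1, MvPolynomial.X 1] :
        Fin 3 → MvPolynomial (Fin 2) ℚ) i)) = ![y 0, y 1, y 1] := by
      funext i; fin_cases i <;> simp
    show WordLayer.layerF P β₀ β₁ γ₁ γ₂ α (sw3 (Fin.snoc y (y 0))) - WordLayer.layerF P β₀ β₁ γ₁ γ₂ α (sw3 (Fin.snoc y (y 1))) = _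
    rw [e1, e0]
    simp only [WordLayer.layerF, ibpB1, map_sub, map_mul, map_pow, MvPolynomial.aeval_bind₁, g1, g0, MvPolynomial.aeval_X,
      map_one, Matrix.cons_val_zero, Matrix.cons_val_one, Matrix.head_cons, Matrix.cons_val_two, Matrix.tail_cons]
    field_simp
    ring
  · have e : KZ.of r - KZ.of r' = (KZ.of r - KZ.of (swapRep3 r hd)) + (KZ.of (swapRep3 r hd) - KZ.of r') := by abel
    rw [e]
    exact add_mem h1 hrel

end IBPT1

end Summit.KontsevichZagierPeriods.KontsevichZagierPeriods.Theorems.RootDecompZetaThreeFrontierWordMoves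

namespace Summit.KontsevichZagierPeriods.KontsevichZagierPeriods.Cruxes.GZNormalFormWThree.GZLadder

open Set MeasureTheory Literature.NumberTheory.Transcendental
open Summit.KontsevichZagierPeriods.RootDecompZetaThreeFrontier
open Summit.KontsevichZagierPeriods.KontsevichZagierPeriods.Theorems.RootDecompZetaThreeFrontierWordMoves (ibpQ1 ibpB1 ibpT1)

/-- **THE t₁-IBP ENGINE in route vocabulary**: every class `ibpQ1(P)/(t₀^β₀ t₁^{β₁+1} (1-t₁)^{γ₁+1} (1-t₂)^{γ₂} (t₀-t₂)^{α})` on `Δ₃` is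
`CongInto (layerThree ∪ gzLETwo)` (the swap move + one Newton–Leibniz move land it in `GZ₂`). -/
theorem congInto_of_ibpT1 (P : MvPolynomial (Fin 3) ℚ) (β₀ β₁ γ₁ γ₂ α : ℕ) (r : KZ.IntegralRep 3) (hd : r.domain = simplex 3)
    (hi : EqOn r.integrand (WordLayer.layerF (ibpQ1 P β₁ γ₁) β₀ (β₁ + 1) (γ₁ + 1) γ₂ α) r.domain) :
    CongInto (layerThree ∪ gzLETwo) (KZ.of r) := by
  obtain ⟨r', hd', hi', hrel⟩ := ibpT1 P β₀ β₁ γ₁ γ₂ α r hd hi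
  refine ⟨KZ.of r', AddSubgroup.subset_closure (Or.inr ⟨2, r', le_rfl, ⟨hd', ibpB1 P β₁ γ₁, fun _ _ => α, ![β₀ + β₁, β₁],
    ![γ₁, γ₁ + γ₂], fun y hy => ?_⟩, rfl⟩), hrel⟩
  rw [hi' hy]
  simp [Fin.prod_univ_two, mul_assoc]

end Summit.KontsevichZagierPeriods.KontsevichZagierPeriods.Cruxes.GZNormalFormWThree.GZLadder

/-! # §33  ONE-STEP LOWERING LEMMAS (decomp-kz lens-1 gen 11): the three engines turned into INDUCTION STEPS for `GapClassMatch`.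
For a 5-factor class `N/den(β₀,β₁,γ₁,γ₂,α)` on `Δ₃`:
* `lowerT2`: `α = a+1 ≥ 2` is lowered to `a` (and `γ₂ ↦ γ₂+1`) — `N/den(…,γ₂,a+1) = ibpQ((1/a)N;γ₂,a)/den(…,γ₂+1,a+1) + lowR2/den(…,γ₂+1,a)`,
  `lowR2 = -(1/a)(∂₂N·(1-t₂) + γ₂N)`; the first summand is `GZ₂` by §30, so the class is `CongInto` as soon as the REMAINDER class is
  (and is integrable);
* `lowerT1`: `β₁ = b+1 ≥ 2` is lowered to `b` (and `γ₁ ↦ γ₁+1`) — remainder `lowR1 = (1/b)(∂₁N·(1-t₁) + γ₁N)` (§32);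
* `lowerT0`: `α = a+1 ≥ 2` is lowered to `a` with `β₀ ↦ β₀+1` — remainder `lowR0 = duP3 (lowR2 (duP3 N) β₀ a)` (§31 + `lowerT2`).
What is left for `GapClassMatch` after §33 is ONLY the integrability bookkeeping of the remainders (order conditions §23/§26) and the
choice of direction (the experiment `exp/` shows T2/T0/T1 + layer always suffice for exponents ≤ 2, |κ| ≤ 3). -/

namespace Summit.KontsevichZagierPeriods.RootDecompZetaThreeFrontier.WordLayer

open Set MeasureTheory Literature.NumberTheory.Transcendental
open Summit.KontsevichZagierPeriods.KontsevichZagierPeriods.Theorems.RootDecompZetaThreeFrontierWordMoves (mem_simplex_three_iff ibpQ1)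

section LowerSteps

/-- Auxiliary step `duP3_duP3`. [bookkeeping] -/
theorem duP3_duP3 (p : MvPolynomial (Fin 3) ℚ) : duP3 (duP3 p) = p := by
  have h : duP3.comp duP3 = AlgHom.id ℚ (MvPolynomial (Fin 3) ℚ) := by
    apply MvPolynomial.algHom_ext
    intro i
    fin_cases i <;> simp [duP3]
  exact AlgHom.congr_fun h p

/-- the t₂-lowering remainder numerator `-(1/a)(∂₂N·(1-t₂) + γ₂ N)` -/
noncomputable def lowR2 (N : MvPolynomial (Fin 3) ℚ) (γ₂ a : ℕ) : MvPolynomial (Fin 3) ℚ :=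
  -(MvPolynomial.C (1 / (a : ℚ)) * (MvPolynomial.pderiv 2 N * (MvPolynomial.C 1 - MvPolynomial.X 2) + MvPolynomial.C (γ₂ : ℚ) * N))

/-- the t₁-lowering remainder numerator `(1/b)(∂₁N·(1-t₁) + γ₁ N)` -/
noncomputable def lowR1 (N : MvPolynomial (Fin 3) ℚ) (γ₁ b : ℕ) : MvPolynomial (Fin 3) ℚ :=
  MvPolynomial.C (1 / (b : ℚ)) * (MvPolynomial.pderiv 1 N * (MvPolynomial.C 1 - MvPolynomial.X 1) + MvPolynomial.C (γ₁ : ℚ) * N)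

/-- the t₀-lowering remainder numerator (σ₃-conjugate of `lowR2`) -/
noncomputable def lowR0 (N : MvPolynomial (Fin 3) ℚ) (β₀ a : ℕ) : MvPolynomial (Fin 3) ℚ :=
  duP3 (lowR2 (duP3 N) β₀ a)

/-- Auxiliary step `simplex3_facts`. [bookkeeping] -/
theorem simplex3_facts {t : Fin 3 → ℝ} (ht : t ∈ KZ.openOrderedSimplex 3) :
    t 0 ≠ 0 ∧ t 1 ≠ 0 ∧ (1 : ℝ) - t 1 ≠ 0 ∧ (1 : ℝ) - t 2 ≠ 0 ∧ t 0 - t 2 ≠ 0 := by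
  obtain ⟨h2, h21, h10, h0⟩ := (mem_simplex_three_iff t).1 ht
  exact ⟨by linarith, by linarith, by linarith, by linarith, by linarith⟩

/-- the t₂-lowering identity on `Δ₃` -/
theorem lowerT2_identity (N : MvPolynomial (Fin 3) ℚ) (β₀ β₁ γ₁ γ₂ a : ℕ) (ha : 1 ≤ a) {t : Fin 3 → ℝ}
    (ht : t ∈ KZ.openOrderedSimplex 3) :
    layerF N β₀ β₁ γ₁ γ₂ (a + 1) t - layerF (lowR2 N γ₂ a) β₀ β₁ γ₁ (γ₂ + 1) a t =
      layerF (ibpQ (MvPolynomial.C (1 / (a : ℚ)) * N) γ₂ a) β₀ β₁ γ₁ (γ₂ + 1) (a + 1) t := by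
  obtain ⟨h0, h1, h1', h2', hd⟩ := simplex3_facts ht
  have ha' : (a : ℝ) ≠ 0 := by exact_mod_cast (show a ≠ 0 by omega)
  simp only [layerF, lowR2, ibpQ, MvPolynomial.pderiv_C_mul, map_add, map_mul, map_sub, map_neg, MvPolynomial.aeval_C,
    MvPolynomial.aeval_X, map_natCast, map_one, one_div, eq_ratCast, Rat.cast_inv, Rat.cast_natCast]
  field_simp
  ring

/-- the t₁-lowering identity on `Δ₃` -/
theorem lowerT1_identity (N : MvPolynomial (Fin 3) ℚ) (β₀ b γ₁ γ₂ α : ℕ) (hb : 1 ≤ b) {t : Fin 3 → ℝ}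
    (ht : t ∈ KZ.openOrderedSimplex 3) :
    layerF N β₀ (b + 1) γ₁ γ₂ α t - layerF (lowR1 N γ₁ b) β₀ b (γ₁ + 1) γ₂ α t =
      layerF (ibpQ1 (MvPolynomial.C (-(1 / (b : ℚ))) * N) b γ₁) β₀ (b + 1) (γ₁ + 1) γ₂ α t := by
  obtain ⟨h0, h1, h1', h2', hd⟩ := simplex3_facts ht
  have hb' : (b : ℝ) ≠ 0 := by exact_mod_cast (show b ≠ 0 by omega)
  simp only [layerF, lowR1, ibpQ1, MvPolynomial.pderiv_C_mul, map_add, map_mul, map_sub, MvPolynomial.aeval_C,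
    MvPolynomial.aeval_X, map_natCast, map_one, one_div, eq_ratCast, Rat.cast_inv, Rat.cast_neg, Rat.cast_natCast]
  field_simp
  ring

end LowerSteps

end Summit.KontsevichZagierPeriods.RootDecompZetaThreeFrontier.WordLayer

namespace Summit.KontsevichZagierPeriods.KontsevichZagierPeriods.Cruxes.GZNormalFormWThree.GZLadder

open Set MeasureTheory Literature.NumberTheory.Transcendental
open Summit.KontsevichZagierPeriods.RootDecompZetaThreeFrontier
open Summit.KontsevichZagierPeriods.KontsevichZagierPeriods.Theorems.RootDecompZetaThreeFrontierWordMoves (measurableSet_simplex ibpQ1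
  dualRep3 dualRep3_integrand mem_simplex_three_duΦ integrableOn_comp_duΦ)

/-- **t₂-LOWERING STEP** (`α = a+1 ↦ a`, `γ₂ ↦ γ₂+1`): if the remainder class `lowR2(N)/den(β₀,β₁,γ₁,γ₂+1,a)` is integrable on `Δ₃` and
`CongInto`, then so is `N/den(β₀,β₁,γ₁,γ₂,a+1)`. -/
theorem lowerT2 (N : MvPolynomial (Fin 3) ℚ) (β₀ β₁ γ₁ γ₂ a : ℕ) (ha : 1 ≤ a)
    (hRint : IntegrableOn (WordLayer.layerF (WordLayer.lowR2 N γ₂ a) β₀ β₁ γ₁ (γ₂ + 1) a) (KZ.openOrderedSimplex 3))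
    (hR : ∀ s : KZ.IntegralRep 3, s.domain = simplex 3 →
      EqOn s.integrand (WordLayer.layerF (WordLayer.lowR2 N γ₂ a) β₀ β₁ γ₁ (γ₂ + 1) a) s.domain → CongInto (layerThree ∪ gzLETwo) (KZ.of s))
    (r : KZ.IntegralRep 3) (hd : r.domain = simplex 3) (hi : EqOn r.integrand (WordLayer.layerF N β₀ β₁ γ₁ γ₂ (a + 1)) r.domain) :
    CongInto (layerThree ∪ gzLETwo) (KZ.of r) := by
  have hrint : IntegrableOn (WordLayer.layerF N β₀ β₁ γ₁ γ₂ (a + 1)) (KZ.openOrderedSimplex 3) := by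
    have h := r.integrableOn
    rw [hd] at h
    exact h.congr_fun (fun z hz => hi (by rw [hd]; exact hz)) (measurableSet_simplex 3)
  let rR := WordLayer.repThree _ (WordLayer.layerF_sa (WordLayer.lowR2 N γ₂ a) β₀ β₁ γ₁ (γ₂ + 1) a) hRint
  let rT := WordLayer.repThree (fun z => WordLayer.layerF N β₀ β₁ γ₁ γ₂ (a + 1) z - WordLayer.layerF (WordLayer.lowR2 N γ₂ a) β₀ β₁ γ₁ (γ₂ + 1) a z)
    (IsSemialgebraicFunOn.sub_holds (WordLayer.layerF_sa N β₀ β₁ γ₁ γ₂ (a + 1)) (WordLayer.layerF_sa (WordLayer.lowR2 N γ₂ a) β₀ β₁ γ₁ (γ₂ + 1) a))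
    (hrint.sub hRint)
  refine WordLayer.of_add_split3 _ r rT rR hd rfl rfl (fun z hz => ?_) ?_ (hR rR rfl fun _ _ => rfl)
  · rw [hi (by rw [hd]; exact hz)]
    simp [rT, rR, WordLayer.repThree]
  · exact congInto_of_ibpT2 (MvPolynomial.C (1 / (a : ℚ)) * N) β₀ β₁ γ₁ γ₂ a rT rfl fun z hz =>
      WordLayer.lowerT2_identity N β₀ β₁ γ₁ γ₂ a ha hz

/-- **t₁-LOWERING STEP** (`β₁ = b+1 ↦ b`, `γ₁ ↦ γ₁+1`). -/
theorem lowerT1 (N : MvPolynomial (Fin 3) ℚ) (β₀ b γ₁ γ₂ α : ℕ) (hb : 1 ≤ b)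
    (hRint : IntegrableOn (WordLayer.layerF (WordLayer.lowR1 N γ₁ b) β₀ b (γ₁ + 1) γ₂ α) (KZ.openOrderedSimplex 3))
    (hR : ∀ s : KZ.IntegralRep 3, s.domain = simplex 3 →
      EqOn s.integrand (WordLayer.layerF (WordLayer.lowR1 N γ₁ b) β₀ b (γ₁ + 1) γ₂ α) s.domain → CongInto (layerThree ∪ gzLETwo) (KZ.of s))
    (r : KZ.IntegralRep 3) (hd : r.domain = simplex 3) (hi : EqOn r.integrand (WordLayer.layerF N β₀ (b + 1) γ₁ γ₂ α) r.domain) :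
    CongInto (layerThree ∪ gzLETwo) (KZ.of r) := by
  have hrint : IntegrableOn (WordLayer.layerF N β₀ (b + 1) γ₁ γ₂ α) (KZ.openOrderedSimplex 3) := by
    have h := r.integrableOn
    rw [hd] at h
    exact h.congr_fun (fun z hz => hi (by rw [hd]; exact hz)) (measurableSet_simplex 3)
  let rR := WordLayer.repThree _ (WordLayer.layerF_sa (WordLayer.lowR1 N γ₁ b) β₀ b (γ₁ + 1) γ₂ α) hRint
  let rT := WordLayer.repThree (fun z => WordLayer.layerF N β₀ (b + 1) γ₁ γ₂ α z - WordLayer.layerF (WordLayer.lowR1 N γ₁ b) β₀ b (γ₁ + 1) γ₂ α z)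
    (IsSemialgebraicFunOn.sub_holds (WordLayer.layerF_sa N β₀ (b + 1) γ₁ γ₂ α) (WordLayer.layerF_sa (WordLayer.lowR1 N γ₁ b) β₀ b (γ₁ + 1) γ₂ α))
    (hrint.sub hRint)
  refine WordLayer.of_add_split3 _ r rT rR hd rfl rfl (fun z hz => ?_) ?_ (hR rR rfl fun _ _ => rfl)
  · rw [hi (by rw [hd]; exact hz)]
    simp [rT, rR, WordLayer.repThree]
  · exact congInto_of_ibpT1 (MvPolynomial.C (-(1 / (b : ℚ))) * N) β₀ b γ₁ γ₂ α rT rfl fun z hz =>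
      WordLayer.lowerT1_identity N β₀ b γ₁ γ₂ α hb hz

/-- **t₀-LOWERING STEP** (`α = a+1 ↦ a`, `β₀ ↦ β₀+1`; the σ₃-conjugate of `lowerT2`). -/
theorem lowerT0 (N : MvPolynomial (Fin 3) ℚ) (β₀ β₁ γ₁ γ₂ a : ℕ) (ha : 1 ≤ a)
    (hRint : IntegrableOn (WordLayer.layerF (WordLayer.lowR0 N β₀ a) (β₀ + 1) β₁ γ₁ γ₂ a) (KZ.openOrderedSimplex 3))
    (hR : ∀ s : KZ.IntegralRep 3, s.domain = simplex 3 →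
      EqOn s.integrand (WordLayer.layerF (WordLayer.lowR0 N β₀ a) (β₀ + 1) β₁ γ₁ γ₂ a) s.domain → CongInto (layerThree ∪ gzLETwo) (KZ.of s))
    (r : KZ.IntegralRep 3) (hd : r.domain = simplex 3) (hi : EqOn r.integrand (WordLayer.layerF N β₀ β₁ γ₁ γ₂ (a + 1)) r.domain) :
    CongInto (layerThree ∪ gzLETwo) (KZ.of r) := by
  refine congInto_of_dual _ r hd (lowerT2 (WordLayer.duP3 N) γ₂ γ₁ β₁ β₀ a ha ?_ (fun s hs hsi => ?_) (dualRep3 r hd) rfl fun t ht => ?_)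
  · refine (integrableOn_comp_duΦ hRint).congr_fun (fun t _ => ?_) (measurableSet_simplex 3)
    show WordLayer.layerF (WordLayer.lowR0 N β₀ a) (β₀ + 1) β₁ γ₁ γ₂ a _ = _
    rw [layerF_duΦ, WordLayer.lowR0, WordLayer.duP3_duP3]
  · refine congInto_of_dual _ s hs (hR (dualRep3 s hs) rfl fun t ht => ?_)
    rw [dualRep3_integrand, hsi (by rw [hs]; exact mem_simplex_three_duΦ ht), layerF_duΦ, WordLayer.lowR0]
  · rw [dualRep3_integrand, hi (by rw [hd]; exact mem_simplex_three_duΦ ht), layerF_duΦ]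

end Summit.KontsevichZagierPeriods.KontsevichZagierPeriods.Cruxes.GZNormalFormWThree.GZLadder

/-! # §34  FREE DIRECTIONS, THE γ₁-PRESERVING t₁-STEP AND THE DUAL t₁-STEPS (decomp-kz lens-1 gen 11).
* `antider i N` — a polynomial antiderivative (`pderiv i (antider i N) = N`);
* FREE DIRECTIONS: a class whose two boundary exponents in one direction vanish is `CongInto` for EVERY numerator:
  `freeT2` (γ₂ = α = 0), `freeT0` (β₀ = α = 0), `freeT1` (β₁ = γ₁ = 0) — integrate that variable out completely (engines at `g = a = 0` / `b = c = 0`);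
* `lowerT1'` lowers `β₁ = b+1 ↦ b` KEEPING `γ₁ = c+1 ≥ 1` (remainder `lowR1' = (1/b)(∂₁N(1-X₁) + (b+c)N)` over `den(β₀,b,c+1,γ₂,α)`);
* `lowerT1d` / `lowerT1d'` — the σ₃-conjugates lowering `γ₁` (raising resp. keeping `β₁`). -/

namespace Summit.KontsevichZagierPeriods.RootDecompZetaThreeFrontier.WordLayer

open Set MeasureTheory Literature.NumberTheory.Transcendental
open Summit.KontsevichZagierPeriods.KontsevichZagierPeriods.Theorems.RootDecompZetaThreeFrontierWordMoves (mem_simplex_three_iff ibpQ1)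

section FreeDirections

/-- a polynomial antiderivative in the variable `i` -/
noncomputable def antider (i : Fin 3) (N : MvPolynomial (Fin 3) ℚ) : MvPolynomial (Fin 3) ℚ :=
  ∑ e ∈ N.support, MvPolynomial.monomial (e + Finsupp.single i 1) (MvPolynomial.coeff e N / ((e i : ℚ) + 1))

/-- Auxiliary step `pderiv_antider`. [bookkeeping] -/
theorem pderiv_antider (i : Fin 3) (N : MvPolynomial (Fin 3) ℚ) : MvPolynomial.pderiv i (antider i N) = N := by
  conv_rhs => rw [N.as_sum]
  simp only [antider, map_sum, MvPolynomial.pderiv_monomial, add_tsub_cancel_right]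
  refine Finset.sum_congr rfl fun e _ => ?_
  congr 1
  have : ((e i : ℚ) + 1) ≠ 0 := by positivity
  simp only [Finsupp.coe_add, Pi.add_apply, Finsupp.single_eq_same, Nat.cast_add, Nat.cast_one]
  exact div_mul_cancel₀ _ this

/-- the γ₁-preserving t₁-remainder numerator `(1/b)(∂₁N·(1-t₁) + (b+c) N)` -/
noncomputable def lowR1' (N : MvPolynomial (Fin 3) ℚ) (b c : ℕ) : MvPolynomial (Fin 3) ℚ :=
  MvPolynomial.C (1 / (b : ℚ)) * (MvPolynomial.pderiv 1 N * (MvPolynomial.C 1 - MvPolynomial.X 1) + MvPolynomial.C ((b + c : ℕ) : ℚ) * N)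

/-- σ₃-conjugate remainders for the γ₁-lowering steps -/
noncomputable def lowR1d (N : MvPolynomial (Fin 3) ℚ) (β₁ c : ℕ) : MvPolynomial (Fin 3) ℚ := duP3 (lowR1 (duP3 N) β₁ c)
/-- Auxiliary step `lowR1d'`. [bookkeeping] -/
noncomputable def lowR1d' (N : MvPolynomial (Fin 3) ℚ) (c b : ℕ) : MvPolynomial (Fin 3) ℚ := duP3 (lowR1' (duP3 N) c b)

/-- Auxiliary step `freeT2_identity`. [bookkeeping] -/
theorem freeT2_identity (N : MvPolynomial (Fin 3) ℚ) (β₀ β₁ γ₁ : ℕ) {t : Fin 3 → ℝ} (ht : t ∈ KZ.openOrderedSimplex 3) :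
    layerF N β₀ β₁ γ₁ 0 0 t = layerF (ibpQ (antider 2 N) 0 0) β₀ β₁ γ₁ 1 1 t := by
  obtain ⟨h0, h1, h1', h2', hd⟩ := simplex3_facts ht
  simp only [layerF, ibpQ, pderiv_antider, map_mul, map_sub, MvPolynomial.aeval_X, map_one, map_zero,
    Nat.cast_zero, zero_mul, mul_zero, add_zero, pow_zero, pow_one, mul_one]
  field_simp

/-- Auxiliary step `freeT1_identity`. [bookkeeping] -/
theorem freeT1_identity (N : MvPolynomial (Fin 3) ℚ) (β₀ γ₂ α : ℕ) {t : Fin 3 → ℝ} (ht : t ∈ KZ.openOrderedSimplex 3) :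
    layerF N β₀ 0 0 γ₂ α t = layerF (ibpQ1 (antider 1 N) 0 0) β₀ 1 1 γ₂ α t := by
  obtain ⟨h0, h1, h1', h2', hd⟩ := simplex3_facts ht
  simp only [layerF, ibpQ1, pderiv_antider, map_mul, map_sub, MvPolynomial.aeval_X, map_one,
    Nat.cast_zero, zero_mul, mul_zero, sub_zero, add_zero, pow_zero, pow_one, mul_one, map_zero]
  field_simp

/-- the γ₁-preserving t₁-lowering identity on `Δ₃` -/
theorem lowerT1'_identity (N : MvPolynomial (Fin 3) ℚ) (β₀ b c γ₂ α : ℕ) (hb : 1 ≤ b) {t : Fin 3 → ℝ}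
    (ht : t ∈ KZ.openOrderedSimplex 3) :
    layerF N β₀ (b + 1) (c + 1) γ₂ α t - layerF (lowR1' N b c) β₀ b (c + 1) γ₂ α t =
      layerF (ibpQ1 (MvPolynomial.C (-(1 / (b : ℚ))) * N) b c) β₀ (b + 1) (c + 1) γ₂ α t := by
  obtain ⟨h0, h1, h1', h2', hd⟩ := simplex3_facts ht
  have hb' : (b : ℝ) ≠ 0 := by exact_mod_cast (show b ≠ 0 by omega)
  simp only [layerF, lowR1', ibpQ1, MvPolynomial.pderiv_C_mul, map_add, map_mul, map_sub, MvPolynomial.aeval_C,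
    MvPolynomial.aeval_X, map_natCast, map_one, one_div, eq_ratCast, Rat.cast_inv, Rat.cast_neg, Rat.cast_natCast, Nat.cast_add]
  field_simp
  ring

end FreeDirections

end Summit.KontsevichZagierPeriods.RootDecompZetaThreeFrontier.WordLayer

namespace Summit.KontsevichZagierPeriods.KontsevichZagierPeriods.Cruxes.GZNormalFormWThree.GZLadder

open Set MeasureTheory Literature.NumberTheory.Transcendental
open Summit.KontsevichZagierPeriods.RootDecompZetaThreeFrontier
open Summit.KontsevichZagierPeriods.KontsevichZagierPeriods.Theorems.RootDecompZetaThreeFrontierWordMoves (measurableSet_simplex ibpQ1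
  dualRep3 dualRep3_integrand mem_simplex_three_duΦ integrableOn_comp_duΦ)

/-- **FREE t₂-DIRECTION**: `γ₂ = α = 0` ⟹ `CongInto` for every numerator. -/
theorem freeT2 (N : MvPolynomial (Fin 3) ℚ) (β₀ β₁ γ₁ : ℕ) (r : KZ.IntegralRep 3) (hd : r.domain = simplex 3)
    (hi : EqOn r.integrand (WordLayer.layerF N β₀ β₁ γ₁ 0 0) r.domain) : CongInto (layerThree ∪ gzLETwo) (KZ.of r) :=
  congInto_of_ibpT2 (WordLayer.antider 2 N) β₀ β₁ γ₁ 0 0 r hd fun z hz => by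
    rw [hi hz]; exact WordLayer.freeT2_identity N β₀ β₁ γ₁ (by rw [hd] at hz; exact hz)

/-- **FREE t₁-DIRECTION**: `β₁ = γ₁ = 0` ⟹ `CongInto` for every numerator. -/
theorem freeT1 (N : MvPolynomial (Fin 3) ℚ) (β₀ γ₂ α : ℕ) (r : KZ.IntegralRep 3) (hd : r.domain = simplex 3)
    (hi : EqOn r.integrand (WordLayer.layerF N β₀ 0 0 γ₂ α) r.domain) : CongInto (layerThree ∪ gzLETwo) (KZ.of r) :=
  congInto_of_ibpT1 (WordLayer.antider 1 N) β₀ 0 0 γ₂ α r hd fun z hz => by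
    rw [hi hz]; exact WordLayer.freeT1_identity N β₀ γ₂ α (by rw [hd] at hz; exact hz)

/-- **FREE t₀-DIRECTION**: `β₀ = α = 0` ⟹ `CongInto` for every numerator (σ₃-conjugate of `freeT2`). -/
theorem freeT0 (N : MvPolynomial (Fin 3) ℚ) (β₁ γ₁ γ₂ : ℕ) (r : KZ.IntegralRep 3) (hd : r.domain = simplex 3)
    (hi : EqOn r.integrand (WordLayer.layerF N 0 β₁ γ₁ γ₂ 0) r.domain) : CongInto (layerThree ∪ gzLETwo) (KZ.of r) := by
  refine congInto_of_dual _ r hd (freeT2 (WordLayer.duP3 N) γ₂ γ₁ β₁ (dualRep3 r hd) rfl fun t ht => ?_)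
  rw [dualRep3_integrand, hi (by rw [hd]; exact mem_simplex_three_duΦ ht), layerF_duΦ]

end Summit.KontsevichZagierPeriods.KontsevichZagierPeriods.Cruxes.GZNormalFormWThree.GZLadder
end
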